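import Mathlib
import Summits.MatrixMultiplication.MatrixMultiplication.Theorems.SoloInformedCwTwoValueWeights

/-!
# Door D7 — integer weighted designs compose (submultiplicativity of the door's cost)

Solo seat `solo-MatrixMultiplication-informed`, gen 10.  If `(F, θ)` is an integer weighted digit
design of `S_N` with cost `σ = σ(F)` and `(F', θ')` one of `S_{N'}` with cost `σ'`, then the
concatenation `(F ⊕ (2σ+1)·F', θ ⊕ θ')` is an integer weighted design of `S_{N+N'}` with cost
`σ + (2σ+1)σ'` (`isDoorDesign_append`).  Consequently the door quantity
`a(N) = min {σ(F) + 1 : (F, θ) integer design of S_N}` satisfies `a(N+N') < 2 a(N) a(N')`, so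
`lim a(N)^{1/N}` exists (Fekete) and ONE design with `σ + 1 < 4^N / 2` at a single `N` would give an
exponential improvement `bR(T_{cw,2}^{⊠N}) ≤ (4-δ)^N` for all large `N`: the D7-closure conjecture
`a(N) = 4^N` is all-or-nothing up to the factor `2`.
-/

set_option linter.dupNamespace false

namespace Summit.MatrixMultiplication.MatrixMultiplication.Theorems

open Finset

variable {N N' : ℕ}

/-- Scaling all digits of a system by `c`. [folklore] -/
def scaleDigits (c : ℕ) (F' : Fin N' → Fin 3 → ℕ) : Fin N' → Fin 3 → ℕ := fun k j => c * F' k j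

/-- `σ(c • F') = c · σ(F')`. [folklore] -/
theorem digitSigma_scaleDigits (c : ℕ) (F' : Fin N' → Fin 3 → ℕ) :
    digitSigma (scaleDigits c F') = c * digitSigma F' := by
  simp only [digitSigma, scaleDigits, mul_sum, mul_add]

/-- `σ(F ⊕ G) = σ(F) + σ(G)`. [folklore] -/
theorem digitSigma_append (F : Fin N → Fin 3 → ℕ) (G : Fin N' → Fin 3 → ℕ) :
    digitSigma (Fin.append F G) = digitSigma F + digitSigma G := by
  simp only [digitSigma, Fin.sum_univ_add, Fin.append_left, Fin.append_right]

/-- A word sum over a concatenated system splits into the two halves. [folklore] -/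
theorem sum_append_apply (F : Fin N → Fin 3 → ℕ) (G : Fin N' → Fin 3 → ℕ)
    (u : Fin (N + N') → Fin 3) :
    ∑ k, Fin.append F G k (u k) =
      ∑ i : Fin N, F i (u (Fin.castAdd N' i)) + ∑ i : Fin N', G i (u (Fin.natAdd N i)) := by
  rw [Fin.sum_univ_add]
  simp only [Fin.append_left, Fin.append_right]

/-- A word sum is at most `σ`. [folklore] -/
theorem wordSum_le_digitSigma (F : Fin N → Fin 3 → ℕ) (u : Fin N → Fin 3) :
    ∑ k, F k (u k) ≤ digitSigma F := by
  unfold digitSigma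
  exact sum_le_sum fun k _ => apply_le_sum_three (F k) (u k)

/-- Under `IsDoorDesign`, every relation has weight at least `h₀` (transversal triples have weight
exactly `h₀`). [folklore] -/
theorem weightTotal_le_of_rel (F θ : Fin N → Fin 3 → ℕ)
    (hdes : IsDoorDesign (fun k j => (F k j : ℤ)) θ) (u v w : Fin N → Fin 3)
    (hrel : ∑ k, F k (u k) + ∑ k, F k (v k) + ∑ k, F k (w k) = digitSigma F) :
    weightTotal θ ≤ wordWt θ u + wordWt θ v + wordWt θ w := by
  have hrelZ : wordSum (fun k j => (F k j : ℤ)) u + wordSum (fun k j => (F k j : ℤ)) v +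
      wordSum (fun k j => (F k j : ℤ)) w = ∑ k, ((F k 0 : ℤ) + (F k 1 : ℤ) + (F k 2 : ℤ)) := by
    rw [wordSum_natCast, wordSum_natCast, wordSum_natCast, sigma_natCast]
    exact_mod_cast hrel
  rcases hdes u v w hrelZ with hS | hlt
  · have := wordSum_add_of_distinct θ hS
    simp only [weightTotal, wordWt]
    omega
  · simp only [weightTotal]
    omega

/-- **Designs compose.** If `(F, θ)` and `(F', θ')` are integer weighted digit designs of `S_N` and
`S_{N'}`, then `(F ⊕ (2σ(F)+1)·F', θ ⊕ θ')` is an integer weighted digit design of `S_{N+N'}`: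
a relation of the concatenated system forces (no carries, since word sums of `F` are `≤ σ(F)`)
a relation in each half. [new; seat solo-informed, door D7] -/
theorem isDoorDesign_append (F θ : Fin N → Fin 3 → ℕ) (F' θ' : Fin N' → Fin 3 → ℕ)
    (hdes : IsDoorDesign (fun k j => (F k j : ℤ)) θ)
    (hdes' : IsDoorDesign (fun k j => (F' k j : ℤ)) θ') :
    IsDoorDesign
      (fun k j => (Fin.append F (scaleDigits (2 * digitSigma F + 1) F') k j : ℤ))
      (Fin.append θ θ') := by
  intro u v w hrel
  rw [wordSum_natCast, wordSum_natCast, wordSum_natCast, sigma_natCast] at hrel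
  have hrelN : ∑ k, Fin.append F (scaleDigits (2 * digitSigma F + 1) F') k (u k) +
      ∑ k, Fin.append F (scaleDigits (2 * digitSigma F + 1) F') k (v k) +
      ∑ k, Fin.append F (scaleDigits (2 * digitSigma F + 1) F') k (w k) =
      digitSigma (Fin.append F (scaleDigits (2 * digitSigma F + 1) F')) := by
    unfold digitSigma; exact_mod_cast hrel
  rw [digitSigma_append, digitSigma_scaleDigits, sum_append_apply, sum_append_apply,
    sum_append_apply] at hrelN
  simp only [scaleDigits, ← mul_sum] at hrelN
  -- name the half words and half sums
  set u₁ : Fin N → Fin 3 := fun i => u (Fin.castAdd N' i) with hu₁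
  set v₁ : Fin N → Fin 3 := fun i => v (Fin.castAdd N' i) with hv₁
  set w₁ : Fin N → Fin 3 := fun i => w (Fin.castAdd N' i) with hw₁
  set u₂ : Fin N' → Fin 3 := fun i => u (Fin.natAdd N i) with hu₂
  set v₂ : Fin N' → Fin 3 := fun i => v (Fin.natAdd N i) with hv₂
  set w₂ : Fin N' → Fin 3 := fun i => w (Fin.natAdd N i) with hw₂
  set L := 2 * digitSigma F + 1 with hL
  set X := ∑ i, F i (u₁ i) + ∑ i, F i (v₁ i) + ∑ i, F i (w₁ i) with hX
  set Y := ∑ i, F' i (u₂ i) + ∑ i, F' i (v₂ i) + ∑ i, F' i (w₂ i) with hY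
  have hXY : X + L * Y = digitSigma F + L * digitSigma F' := by
    simp only [hX, hY, mul_add]
    have := hrelN
    simp only [hu₁, hv₁, hw₁, hu₂, hv₂, hw₂] at this ⊢
    linarith
  have hXle : X ≤ 3 * digitSigma F := by
    have h1 := wordSum_le_digitSigma F u₁
    have h2 := wordSum_le_digitSigma F v₁
    have h3 := wordSum_le_digitSigma F w₁
    omega
  -- no carries: `Y = σ'` and `X = σ`
  have hYeq : Y = digitSigma F' := by
    rcases lt_trichotomy Y (digitSigma F') with hlt | heq | hgt
    · exfalso
      have h1 : L * (Y + 1) ≤ L * digitSigma F' := Nat.mul_le_mul_left L hlt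
      have h2 : L * (Y + 1) = L * Y + L := by ring
      omega
    · exact heq
    · exfalso
      have h1 : L * (digitSigma F' + 1) ≤ L * Y := Nat.mul_le_mul_left L hgt
      have h2 : L * (digitSigma F' + 1) = L * digitSigma F' + L := by ring
      omega
  have hXeq : X = digitSigma F := by
    rw [hYeq] at hXY; omega
  -- apply both hypotheses
  have hw1 := weightTotal_le_of_rel F θ hdes u₁ v₁ w₁ (by rw [← hXeq])
  have hw2 := weightTotal_le_of_rel F' θ' hdes' u₂ v₂ w₂ (by rw [← hYeq])
  have hrel1 : wordSum (fun k j => (F k j : ℤ)) u₁ + wordSum (fun k j => (F k j : ℤ)) v₁ +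
      wordSum (fun k j => (F k j : ℤ)) w₁ = ∑ k, ((F k 0 : ℤ) + (F k 1 : ℤ) + (F k 2 : ℤ)) := by
    rw [wordSum_natCast, wordSum_natCast, wordSum_natCast, sigma_natCast]
    exact_mod_cast hXeq
  have hrel2 : wordSum (fun k j => (F' k j : ℤ)) u₂ + wordSum (fun k j => (F' k j : ℤ)) v₂ +
      wordSum (fun k j => (F' k j : ℤ)) w₂ = ∑ k, ((F' k 0 : ℤ) + (F' k 1 : ℤ) + (F' k 2 : ℤ)) := by
    rw [wordSum_natCast, wordSum_natCast, wordSum_natCast, sigma_natCast]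
    exact_mod_cast hYeq
  -- total weight splits
  have hwt : ∀ x : Fin (N + N') → Fin 3, wordWt (Fin.append θ θ') x =
      wordWt θ (fun i => x (Fin.castAdd N' i)) + wordWt θ' (fun i => x (Fin.natAdd N i)) := by
    intro x
    simp only [wordWt, Fin.sum_univ_add, Fin.append_left, Fin.append_right]
  have htot : ∑ k, (Fin.append θ θ' k 0 + Fin.append θ θ' k 1 + Fin.append θ θ' k 2) =
      weightTotal θ + weightTotal θ' := by
    simp only [weightTotal, Fin.sum_univ_add, Fin.append_left, Fin.append_right]
  rcases hdes u₁ v₁ w₁ hrel1 with hS1 | hlt1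
  · rcases hdes' u₂ v₂ w₂ hrel2 with hS2 | hlt2
    · left
      intro k
      refine Fin.addCases (motive := fun k => u k ≠ v k ∧ u k ≠ w k ∧ v k ≠ w k) ?_ ?_ k
      · intro i; exact hS1 i
      · intro i; exact hS2 i
    · right
      rw [htot, hwt u, hwt v, hwt w]
      simp only [weightTotal] at hw1 hlt2 ⊢
      change weightTotal θ ≤ wordWt θ u₁ + wordWt θ v₁ + wordWt θ w₁ at hw1
      simp only [weightTotal] at hw1
      have : wordWt θ' u₂ + wordWt θ' v₂ + wordWt θ' w₂ =
          wordWt θ' (fun i => u (Fin.natAdd N i)) + wordWt θ' (fun i => v (Fin.natAdd N i)) +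
            wordWt θ' (fun i => w (Fin.natAdd N i)) := rfl
      have h1' : wordWt θ u₁ + wordWt θ v₁ + wordWt θ w₁ =
          wordWt θ (fun i => u (Fin.castAdd N' i)) + wordWt θ (fun i => v (Fin.castAdd N' i)) +
            wordWt θ (fun i => w (Fin.castAdd N' i)) := rfl
      omega
  · right
    rw [htot, hwt u, hwt v, hwt w]
    change weightTotal θ' ≤ wordWt θ' u₂ + wordWt θ' v₂ + wordWt θ' w₂ at hw2
    simp only [weightTotal] at hlt1 hw2 ⊢
    have : wordWt θ' u₂ + wordWt θ' v₂ + wordWt θ' w₂ =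
        wordWt θ' (fun i => u (Fin.natAdd N i)) + wordWt θ' (fun i => v (Fin.natAdd N i)) +
          wordWt θ' (fun i => w (Fin.natAdd N i)) := rfl
    have h1' : wordWt θ u₁ + wordWt θ v₁ + wordWt θ w₁ =
        wordWt θ (fun i => u (Fin.castAdd N' i)) + wordWt θ (fun i => v (Fin.castAdd N' i)) +
          wordWt θ (fun i => w (Fin.castAdd N' i)) := rfl
    omega

/-- **Submultiplicativity of the door's cost**: from integer designs of `S_N` (cost `σ`) and
`S_{N'}` (cost `σ'`), `bR(T_{cw,2}^{⊠(N+N')}) ≤ σ + (2σ+1)σ' + 1 < 2(σ+1)(σ'+1)`.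
[new; seat solo-informed, door D7] -/
theorem algBorderRank_kroneckerPow_cwTensor_two_add_le (F θ : Fin N → Fin 3 → ℕ)
    (F' θ' : Fin N' → Fin 3 → ℕ)
    (hdes : IsDoorDesign (fun k j => (F k j : ℤ)) θ)
    (hdes' : IsDoorDesign (fun k j => (F' k j : ℤ)) θ') :
    Literature.Computability.AlgebraicComplexity.algBorderRank
        (Literature.Computability.AlgebraicComplexity.kroneckerPow
          (Literature.Computability.AlgebraicComplexity.cwTensor ℂ 2) (N + N')) ≤
      digitSigma F + (2 * digitSigma F + 1) * digitSigma F' + 1 := by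
  have h := algBorderRank_kroneckerPow_cwTensor_two_le_sigma_succ _ _
    (isDoorDesign_append F θ F' θ' hdes hdes')
  rwa [digitSigma_append, digitSigma_scaleDigits] at h

end Summit.MatrixMultiplication.MatrixMultiplication.Theorems
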